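import Mathlib
import Summits.CriticalPhenomena.PercolationContinuityZ3.Theorems.PercNearOneGluingNoHeavyLowerTailMomentRatioTNInvOdds
import Summits.CriticalPhenomena.PercolationContinuityZ3.Theorems.PercNearOneGluingNoHeavyLowerTailRegionII
import HarnessLib

/-!
# THEOREM N⁷: THEOREM N's two-ray class is TP_∞ for EVERY `θ > 0`, EVERY Ewens level `s > −1` and EVERY `q_A > p_A`

Support file for the Sahi / Conjecture-P programme of route `PercNearOneGluingNoHeavy`
(`--supports stmt-CriticalPhenomena-4575`, prover prim-l12-p5 gen 42; proof note
`prim-l12-p5/PROOF-TN-ALL-RAYS-g42.md` §2).  No definitions, no named facts, no sorries.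

g36 (6′.0): the smoothed x-Laplace kernel of `F_s` (`Ψ = (1+p_Au+q_Av)(1+p_Bu+q_Bv)^θ`, `γ = s+1`, `g = g_B`) is TN iff
`μ_r(λ) = ∏_{m≤r} a_m/(a_m+λ)` is a Hausdorff moment sequence, `λ = 1/g_A`, `a_m = m P_θ(m−1)/(γ Q_θ(m))` the W♯ odds of
the pure grabber `c̃ = γQ_θ/P_θ(·−1)`.  After gens 36–41 this was proved for `θ + s ≥ 0` (CONJECTURE A′, all λ) and for
`g_A ≥ g_B` (N⁵), leaving the cell `{θ < 1, −1 < s < −θ, g_A < g_B}` where A′ is false.  LEMMA Q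
(`…LowerTailMomentRatioTNInvOdds`: `1/τ − 1` CM ⟹ `∏τ` CM) asks only for `λ·c̃_m/m = λ/a_m` to be completely monotone,
and by the level-raising identity `1 + g·a_θ(m) = Q_{θ+1}(m)/Q_θ(m)` (g37 (★))
`1/a_m = g·ρ_{θ+1}(m)/(1 − ρ_{θ+1}(m))`, `ρ_{θ+1} = Q_θ/Q_{θ+1}`, which IS completely monotone for every `θ > 0`,
`γ > 0` because `ρ_{θ+1}` is (Region I: g37 `hyp_inv_altSum_aux'`; Region II: THEOREM RII, `hyp_inv_ratio_altSum_regionII`):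

* `hyp_level_raise` — `γ Q_{θ+1}(m) = γ Q_θ(m) + g m P_θ(m−1)`;
* `pureGrabber_invOdds_altSum_nonneg_of_ratio` — `ρ_{θ+1}` CM ⟹ `m ↦ c̃_m/m = 1/a_m` CM on `m ≥ 1`;
* **`lPlusC_div_factorial_tn_pureGrabber_all`** — for `θ = θ₀ + n` (`θ₀ ∈ (0,1]`, `n ∈ ℕ`), `γ > 0`, `0 < g < 1` and EVERY
  `λ > 0`: the W♯ kernel `[(l + λ c̃_r)/(r−l)!]_{l≤r}` is totally nonnegative.
Hence `F_s` is TP_∞ for all parameters of THEOREM N's class; the TP_∞ question of PROOF-TWO-RAY-g34 is closed.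
-/

namespace Summit.CriticalPhenomena.PercolationContinuityZ3.Theorems

namespace HypergeomCM

open Finset MomentRatioTN
open scoped Nat

section

variable (g : ℝ) (H : ℝ → ℝ → ℕ → ℝ)
  (hH : ∀ a c r, H a c r = ∑ k ∈ range (r + 1), (r.choose k : ℝ) * (-g) ^ k *
    ((∏ i ∈ range k, (a + i)) / (∏ i ∈ range k, (c + i))))
include hH

/-- The level-raising identity behind g37's (★): `γ·Q_{θ+1}(m) = γ·Q_θ(m) + g·m·P_θ(m−1)` (so `1 + g·a_θ(m) = Q_{θ+1}(m)/Q_θ(m)`,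
`a` the W♯ odds of the pure grabber); from the a/b relation `hyp_ab` and the b-step `hyp_step` (`θ + 1 ≠ 0`). -/
theorem hyp_level_raise (θ γ : ℝ) (hθ : 0 ≤ θ) (hγ : 0 < γ) : ∀ m : ℕ,
    γ * H (-θ - 1) γ m = γ * H (-θ) γ m + g * (m : ℝ) * H (-θ) (γ + 1) (m - 1) := by
  intro m
  cases m with
  | zero => simp [hyp_zero g H hH]
  | succ r =>
    have hAB := hyp_ab g H hH (-θ - 1) γ r
    have hS := hyp_step g H hH (-θ - 1) γ hγ r
    rw [show -θ - 1 + 1 = -θ by ring] at hAB hS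
    push_cast
    have hθ1 : θ + 1 ≠ 0 := by positivity
    have key : (θ + 1) * (γ * H (-θ - 1) γ (r + 1) - (γ * H (-θ) γ (r + 1) + g * ((r : ℝ) + 1) * H (-θ) (γ + 1) r)) = 0 := by
      linear_combination (-γ) * hAB + ((r : ℝ) + 1) * hS
    rcases mul_eq_zero.1 key with h | h
    · exact absurd h hθ1
    · exact sub_eq_zero.1 h

/-- **`1/a` is completely monotone.**  If `ρ := Q_θ/Q_{θ+1}` is completely monotone then so is
`m ↦ c̃_m/m = γ Q_θ(m)/(m P_θ(m−1)) = 1/a_m` on `m ≥ 1` (`c̃ = γQ_θ/P_θ(·−1)` the pure grabber): by `hyp_level_raise`,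
`c̃_m/m = g·ρ(m)/(1 − ρ(m))` and `1 − ρ` is positive on `m ≥ 1` with completely monotone first difference (LEMMA DB, Leibniz). -/
theorem pureGrabber_invOdds_altSum_nonneg_of_ratio (hg0 : 0 < g) (hg1 : g < 1) (θ γ : ℝ) (hθ : 0 ≤ θ) (hγ : 0 < γ)
    (hu : ∀ k j, 0 ≤ ∑ i ∈ range (k + 1), (-1 : ℝ) ^ i * (k.choose i : ℝ) *
      (H (-θ) γ (j + i) * (H (-θ - 1) γ (j + i))⁻¹))
    (k j : ℕ) :
    0 ≤ ∑ i ∈ range (k + 1), (-1 : ℝ) ^ i * (k.choose i : ℝ) *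
      ((γ * H (-θ) γ (j + i + 1) / H (-θ) (γ + 1) (j + i + 1 - 1)) / ((j + i + 1 : ℕ) : ℝ)) := by
  have hQ : ∀ m, 0 < H (-θ) γ m := fun m => hyp_pos g H hH hg0.le hg1 (-θ) m γ hγ (by linarith)
  have hQ1 : ∀ m, 0 < H (-θ - 1) γ m := fun m => hyp_pos g H hH hg0.le hg1 (-θ - 1) m γ hγ (by linarith)
  have hP : ∀ m, 0 < H (-θ) (γ + 1) m := fun m => hyp_pos g H hH hg0.le hg1 (-θ) m (γ + 1) (by linarith) (by linarith)
  set u : ℕ → ℝ := fun m => H (-θ) γ m * (H (-θ - 1) γ m)⁻¹ with hudef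
  -- f m := 1 - u (m+1) > 0  (level raise: γ Q_{θ+1}(m+1) - γ Q_θ(m+1) = g (m+1) P_θ(m) > 0)
  set f : ℕ → ℝ := fun m => 1 - u (m + 1) with hfdef
  have hf_eq : ∀ m : ℕ, f m = g * ((m : ℝ) + 1) * H (-θ) (γ + 1) m / (γ * H (-θ - 1) γ (m + 1)) := by
    intro m
    have hlr := hyp_level_raise g H hH θ γ hθ hγ (m + 1)
    rw [Nat.add_sub_cancel] at hlr
    push_cast at hlr
    simp only [hfdef, hudef]
    have hC0 := (hQ1 (m + 1)).ne'
    have hγ0 := hγ.ne'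
    field_simp
    linear_combination hlr
  have hfpos : ∀ m, 0 < f m := by
    intro m
    rw [hf_eq]
    exact div_pos (mul_pos (mul_pos hg0 (by positivity)) (hP m)) (mul_pos hγ (hQ1 (m + 1)))
  -- 1/f is CM: the first difference of f is u(m+1) - u(m+2), a difference sequence of the CM sequence u
  have hfinv : ∀ k j, 0 ≤ ∑ i ∈ range (k + 1), (-1 : ℝ) ^ i * (k.choose i : ℝ) * (f (j + i))⁻¹ := by
    refine altSum_inv_nonneg f hfpos fun k j => ?_
    have e : ∀ i : ℕ, f (j + i + 1) - f (j + i) = u (j + 1 + i) - u (j + 1 + i + 1) := by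
      intro i; simp only [hfdef]; ring_nf
    simp_rw [e]
    rw [← altSum_succ u k (j + 1)]
    exact hu (k + 1) (j + 1)
  -- the shifted u is CM
  have hu1 : ∀ k j, 0 ≤ ∑ i ∈ range (k + 1), (-1 : ℝ) ^ i * (k.choose i : ℝ) * u (j + i + 1) := by
    intro k j
    rw [altSum_shift u k j]
    exact hu k (j + 1)
  -- c̃_{m}/m = g · u(m) / f(m-1) for m = j+i+1
  have e : ∀ i : ℕ, (γ * H (-θ) γ (j + i + 1) / H (-θ) (γ + 1) (j + i + 1 - 1)) / ((j + i + 1 : ℕ) : ℝ) =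
      g * (u (j + i + 1) * (f (j + i))⁻¹) := by
    intro i
    rw [Nat.add_sub_cancel, hf_eq (j + i)]
    simp only [hudef]
    have hA := (hQ (j + i + 1)).ne'
    have hB := (hP (j + i)).ne'
    have hC := (hQ1 (j + i + 1)).ne'
    have hγ0 := hγ.ne'
    have hg0' := hg0.ne'
    have hm : ((j + i + 1 : ℕ) : ℝ) ≠ 0 := by positivity
    push_cast
    field_simp
  simp_rw [e]
  have hc := altSum_const_mul g (fun n : ℕ => u (n + 1) * (f n)⁻¹) k j
  have hc' : ∑ i ∈ range (k + 1), (-1 : ℝ) ^ i * (k.choose i : ℝ) * (g * (u (j + i + 1) * (f (j + i))⁻¹)) =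
      g * ∑ i ∈ range (k + 1), (-1 : ℝ) ^ i * (k.choose i : ℝ) * (u (j + i + 1) * (f (j + i))⁻¹) := by
    rw [← hc]
  rw [hc']
  exact mul_nonneg hg0.le (altSum_mul_nonneg (fun m => u (m + 1)) (fun m => (f m)⁻¹) hu1 hfinv k j)

end

/-- **THEOREM N⁷ (TP_∞ of THEOREM N's two-ray class for ALL parameters).**  For `θ = θ₀ + n` (`θ₀ ∈ (0,1]`, `n ∈ ℕ`),
`γ > 0`, `0 < g < 1` and EVERY `λ > 0`: the W♯ kernel `[(l + λ·c̃_r)/(r−l)!]_{l ≤ r}`, `c̃_r = γQ_θ(r)/P_θ(r−1)`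
(`Q_θ = ₂F₁(−θ,−·;γ;g)`, `P_θ = ₂F₁(−θ,−·;γ+1;g)` written as finite Gauss sums), is totally nonnegative.
(λ = 1/g_A, g = g_B, γ = s+1: no condition on θ + s and none on g_A — g37's N⁺⁺⁺ needed `θ + s ≥ 0`, gen 41's N⁵ needed `g_A ≥ g_B`.)
Proof: `ρ_{θ+1}` is CM for every θ > 0 (Region I `hyp_inv_altSum_aux'` or Region II `hyp_inv_ratio_altSum_regionII`),
`pureGrabber_invOdds_altSum_nonneg_of_ratio` (`c̃_m/m` CM), LEMMA Q (`lPlusC_div_factorial_tn_of_inv_odds_ray`). -/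
theorem lPlusC_div_factorial_tn_pureGrabber_all (θ₀ : ℝ) (n : ℕ) (γ g : ℝ) (h0 : 0 < θ₀) (h1 : θ₀ ≤ 1)
    (hγ : 0 < γ) (hg0 : 0 < g) (hg1 : g < 1) (lam : ℝ) (hlam : 0 < lam)
    {k : ℕ} (r c' : Fin k → ℕ) (hr : StrictMono r) (hc' : StrictMono c') :
    0 ≤ (Matrix.of fun i j =>
      if c' j ≤ r i then ((c' j : ℝ) + lam *
        (γ * (∑ l ∈ range (r i + 1), ((r i).choose l : ℝ) * (-g) ^ l *
            ((∏ m ∈ range l, (-(θ₀ + n) + m)) / (∏ m ∈ range l, (γ + m)))) /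
          (∑ l ∈ range (r i - 1 + 1), ((r i - 1).choose l : ℝ) * (-g) ^ l *
            ((∏ m ∈ range l, (-(θ₀ + n) + m)) / (∏ m ∈ range l, (γ + 1 + m)))))) /
        ((r i - c' j)! : ℕ) else 0).det := by
  set P : ℝ → ℝ → ℕ → ℝ := fun a c r => ∑ l ∈ range (r + 1), (r.choose l : ℝ) * (-g) ^ l *
    ((∏ m ∈ range l, (a + m)) / (∏ m ∈ range l, (c + m))) with hPdef
  have hP : ∀ a c r, P a c r = ∑ l ∈ range (r + 1), (r.choose l : ℝ) * (-g) ^ l *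
    ((∏ m ∈ range l, (a + m)) / (∏ m ∈ range l, (c + m))) := fun _ _ _ => rfl
  have hθ : (0 : ℝ) ≤ θ₀ + n := by positivity
  have hQpos : ∀ m, 0 < P (-(θ₀ + n)) γ m := fun m => hyp_pos g P hP hg0.le hg1 (-(θ₀ + n)) m γ hγ (by linarith)
  have hPpos : ∀ m, 0 < P (-(θ₀ + n)) (γ + 1) m :=
    fun m => hyp_pos g P hP hg0.le hg1 (-(θ₀ + n)) m (γ + 1) (by linarith) (by linarith)
  -- ρ_{θ+1} is completely monotone for every θ > 0 (Region I or Region II)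
  have hu : ∀ k j, 0 ≤ ∑ i ∈ range (k + 1), (-1 : ℝ) ^ i * (k.choose i : ℝ) *
      (P (-(θ₀ + n)) γ (j + i) * (P (-(θ₀ + n) - 1) γ (j + i))⁻¹) := by
    intro k j
    rcases le_or_gt (1 - θ₀) γ with hI | hII
    · have h := (hyp_inv_altSum_aux' g P hP hg0.le hg1 γ hγ θ₀ h0 h1 hI (n + 1)).2 k j
      have e1 : (1 : ℝ) - (θ₀ + ((n + 1 : ℕ) : ℝ)) = -(θ₀ + n) := by push_cast; ring
      have e2 : -(θ₀ + ((n + 1 : ℕ) : ℝ)) = -(θ₀ + n) - 1 := by push_cast; ring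
      rw [e1, e2] at h
      exact h
    · have h := (hyp_inv_ratio_altSum_regionII g P hP hg0.le hg1 γ hγ θ₀ h0 (by linarith) n).2 k j
      have e1 : (1 : ℝ) - (θ₀ + 1 + n) = -(θ₀ + n) := by ring
      have e2 : -(θ₀ + 1 + (n : ℝ)) = -(θ₀ + n) - 1 := by ring
      rw [e1, e2] at h
      exact h
  have hψ := pureGrabber_invOdds_altSum_nonneg_of_ratio g P hP hg0 hg1 (θ₀ + n) γ hθ hγ hu
  have := lPlusC_div_factorial_tn_of_inv_odds_ray
    (fun m => γ * P (-(θ₀ + n)) γ m / P (-(θ₀ + n)) (γ + 1) (m - 1))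
    (fun m => div_pos (mul_pos hγ (hQpos m)) (hPpos (m - 1))) hψ lam hlam r c' hr hc'
  simpa only [hPdef] using this

/-- **THEOREM N⁷, W♯ form with dilation** (the literal x-Laplace kernel of `F_s`, cf. g37 `lPlusC_div_factorial_tn_of_pureGrabber_odds`).
Let `θ = θ₀ + n` (`0 < θ₀ ≤ 1`), `γ > 0`, `0 < g < 1`, `0 < κ ≤ 1`, `λ > 0`, and let `a_m = m P(m−1)/(γ Q(m))` be the pure-grabber
odds.  If `c_n > 0` is any sequence whose W♯ moment sequence is `r!/∏_{m≤r}(m + c_m) = κ^r ∏_{m≤r} a_m/(a_m + λ)` — by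
PROOF-THEOREM-H-g36 (1.3)/(6′.0) this is the case for the smoothed `x`-Laplace kernel `M` of `F_s`,
`Ψ = (1+p_A u+q_A v)(1+p_B u+q_B v)^θ`, with `κ = 1 − λ_A/λ_B`, `λ = 1/g_A`, `γ = s+1`, `g = g_B` — then
`[(l + c_n)/(n−l)!]_{l ≤ n}` is totally nonnegative, with NO condition on `θ + s` or on `g_A`: LEMMA Q with
`1/τ_m − 1 = λ/a_m` completely monotone.  Hence `F_s` is TP_∞ for every parameter of THEOREM N's class. -/
theorem lPlusC_div_factorial_tn_of_pureGrabber_odds_all (θ₀ : ℝ) (n : ℕ) (γ g κ lam : ℝ) (h0 : 0 < θ₀) (h1 : θ₀ ≤ 1)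
    (hγ : 0 < γ) (hg0 : 0 < g) (hg1 : g < 1) (hκ0 : 0 < κ) (hκ1 : κ ≤ 1) (hlam : 0 < lam)
    (c : ℕ → ℝ) (hc : ∀ n, 0 < c n)
    (hμ : ∀ r : ℕ, ((r ! : ℕ) : ℝ) / ∏ m ∈ range r, ((m : ℝ) + 1 + c (m + 1)) =
      κ ^ r * ∏ m ∈ range r,
        ((((m + 1 : ℕ) : ℝ)) *
            (∑ l ∈ range (m + 1), (m.choose l : ℝ) * (-g) ^ l *
              ((∏ i ∈ range l, (-(θ₀ + n) + i)) / (∏ i ∈ range l, (γ + 1 + i)))) /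
          (γ * ∑ l ∈ range (m + 1 + 1), ((m + 1).choose l : ℝ) * (-g) ^ l *
              ((∏ i ∈ range l, (-(θ₀ + n) + i)) / (∏ i ∈ range l, (γ + i)))) /
        ((((m + 1 : ℕ) : ℝ)) *
            (∑ l ∈ range (m + 1), (m.choose l : ℝ) * (-g) ^ l *
              ((∏ i ∈ range l, (-(θ₀ + n) + i)) / (∏ i ∈ range l, (γ + 1 + i)))) /
          (γ * ∑ l ∈ range (m + 1 + 1), ((m + 1).choose l : ℝ) * (-g) ^ l *
              ((∏ i ∈ range l, (-(θ₀ + n) + i)) / (∏ i ∈ range l, (γ + i)))) + lam)))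
    {k : ℕ} (r c' : Fin k → ℕ) (hr : StrictMono r) (hc' : StrictMono c') :
    0 ≤ (Matrix.of fun i j =>
      if c' j ≤ r i then ((c' j : ℝ) + c (r i)) / ((r i - c' j)! : ℕ) else 0).det := by
  set P : ℝ → ℝ → ℕ → ℝ := fun a c r => ∑ l ∈ range (r + 1), (r.choose l : ℝ) * (-g) ^ l *
    ((∏ m ∈ range l, (a + m)) / (∏ m ∈ range l, (c + m))) with hPdef
  have hP : ∀ a c r, P a c r = ∑ l ∈ range (r + 1), (r.choose l : ℝ) * (-g) ^ l *
    ((∏ m ∈ range l, (a + m)) / (∏ m ∈ range l, (c + m))) := fun _ _ _ => rfl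
  have hθ : (0 : ℝ) ≤ θ₀ + n := by positivity
  have hQpos : ∀ m, 0 < P (-(θ₀ + n)) γ m := fun m => hyp_pos g P hP hg0.le hg1 (-(θ₀ + n)) m γ hγ (by linarith)
  have hPpos : ∀ m, 0 < P (-(θ₀ + n)) (γ + 1) m :=
    fun m => hyp_pos g P hP hg0.le hg1 (-(θ₀ + n)) m (γ + 1) (by linarith) (by linarith)
  -- the odds a_m = m P(m-1)/(γ Q(m)) as a sequence on ℕ
  set a : ℕ → ℝ := fun m => ((m : ℕ) : ℝ) * P (-(θ₀ + n)) (γ + 1) (m - 1) / (γ * P (-(θ₀ + n)) γ m) with hadef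
  have ha : ∀ m, 0 < a (m + 1) := fun m => by
    simp only [hadef, Nat.add_sub_cancel]
    exact div_pos (mul_pos (by positivity) (hPpos m)) (mul_pos hγ (hQpos (m + 1)))
  -- ρ_{θ+1} is completely monotone for every θ > 0 (Region I or Region II)
  have hu : ∀ k j, 0 ≤ ∑ i ∈ range (k + 1), (-1 : ℝ) ^ i * (k.choose i : ℝ) *
      (P (-(θ₀ + n)) γ (j + i) * (P (-(θ₀ + n) - 1) γ (j + i))⁻¹) := by
    intro k j
    rcases le_or_gt (1 - θ₀) γ with hI | hII
    · have h := (hyp_inv_altSum_aux' g P hP hg0.le hg1 γ hγ θ₀ h0 h1 hI (n + 1)).2 k j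
      have e1 : (1 : ℝ) - (θ₀ + ((n + 1 : ℕ) : ℝ)) = -(θ₀ + n) := by push_cast; ring
      have e2 : -(θ₀ + ((n + 1 : ℕ) : ℝ)) = -(θ₀ + n) - 1 := by push_cast; ring
      rw [e1, e2] at h
      exact h
    · have h := (hyp_inv_ratio_altSum_regionII g P hP hg0.le hg1 γ hγ θ₀ h0 (by linarith) n).2 k j
      have e1 : (1 : ℝ) - (θ₀ + 1 + n) = -(θ₀ + n) := by ring
      have e2 : -(θ₀ + 1 + (n : ℝ)) = -(θ₀ + n) - 1 := by ring
      rw [e1, e2] at h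
      exact h
  -- 1/a is completely monotone on m ≥ 1
  have hψ := pureGrabber_invOdds_altSum_nonneg_of_ratio g P hP hg0 hg1 (θ₀ + n) γ hθ hγ hu
  refine MomentRatioTN.lPlusC_div_factorial_tn c hc (fun k j => ?_) r c' hr hc'
  have hμ' : ∀ r : ℕ, ((r ! : ℕ) : ℝ) / ∏ m ∈ range r, ((m : ℝ) + 1 + c (m + 1)) =
      κ ^ r * ∏ m ∈ range r, (a (m + 1) / (a (m + 1) + lam)) := by
    intro r
    rw [hμ r]
    simp only [hadef, hPdef, Nat.add_sub_cancel]
  simp only [hμ']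
  refine altSum_mul_pos_of_pos (fun r => κ ^ r) (fun r => ∏ m ∈ range r, (a (m + 1) / (a (m + 1) + lam)))
    (fun r => pow_pos hκ0 r) (altSum_geom_nonneg κ hκ0.le hκ1) (fun k j => ?_) k j
  refine altSum_prod_pos_of_inv (fun m => a m / (a m + lam)) (fun m => by have := ha m; positivity)
    (fun m => by have := ha m; rw [div_lt_one (by positivity)]; linarith) (fun k' j' => ?_) k j
  -- 1/τ − 1 = λ/a = λ · (c̃_m/m)
  have e : ∀ i : ℕ, (a (j' + i + 1) / (a (j' + i + 1) + lam))⁻¹ - 1 =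
      lam * ((γ * P (-(θ₀ + n)) γ (j' + i + 1) / P (-(θ₀ + n)) (γ + 1) (j' + i + 1 - 1)) / ((j' + i + 1 : ℕ) : ℝ)) := by
    intro i
    have hA := ha (j' + i)
    simp only [hadef, Nat.add_sub_cancel] at hA ⊢
    have hQ0 := (hQpos (j' + i + 1)).ne'
    have hP0 := (hPpos (j' + i)).ne'
    have hγ0 := hγ.ne'
    have hm : ((j' + i + 1 : ℕ) : ℝ) ≠ 0 := by positivity
    field_simp
    ring
  simp_rw [e]
  rw [altSum_const_mul lam (fun m : ℕ =>
    (γ * P (-(θ₀ + n)) γ (m + 1) / P (-(θ₀ + n)) (γ + 1) (m + 1 - 1)) / ((m + 1 : ℕ) : ℝ)) k' j']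
  refine mul_nonneg hlam.le (le_of_le_of_eq (hψ k' j') (sum_congr rfl fun i _ => ?_))
  simp only [Nat.add_sub_cancel]

/-- **THEOREM N⁷ for an arbitrary real `θ > 0`** (the `θ = θ₀ + n` bookkeeping done internally: `θ₀ = θ − (⌈θ⌉ − 1) ∈ (0,1]`). -/
theorem lPlusC_div_factorial_tn_pureGrabber_all' (θ γ g : ℝ) (hθ : 0 < θ) (hγ : 0 < γ) (hg0 : 0 < g) (hg1 : g < 1)
    (lam : ℝ) (hlam : 0 < lam) {k : ℕ} (r c' : Fin k → ℕ) (hr : StrictMono r) (hc' : StrictMono c') :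
    0 ≤ (Matrix.of fun i j =>
      if c' j ≤ r i then ((c' j : ℝ) + lam *
        (γ * (∑ l ∈ range (r i + 1), ((r i).choose l : ℝ) * (-g) ^ l *
            ((∏ m ∈ range l, (-θ + m)) / (∏ m ∈ range l, (γ + m)))) /
          (∑ l ∈ range (r i - 1 + 1), ((r i - 1).choose l : ℝ) * (-g) ^ l *
            ((∏ m ∈ range l, (-θ + m)) / (∏ m ∈ range l, (γ + 1 + m)))))) /
        ((r i - c' j)! : ℕ) else 0).det := by
  have hceil : 1 ≤ ⌈θ⌉₊ := Nat.one_le_iff_ne_zero.2 (Nat.pos_iff_ne_zero.1 (Nat.ceil_pos.2 hθ))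
  obtain ⟨n, hn1, hn2⟩ : ∃ n : ℕ, (n : ℝ) < θ ∧ θ ≤ n + 1 := by
    refine ⟨⌈θ⌉₊ - 1, ?_, ?_⟩
    · have h1 := Nat.ceil_lt_add_one hθ.le
      rw [Nat.cast_sub hceil, Nat.cast_one]
      linarith
    · have h2 := Nat.le_ceil θ
      rw [Nat.cast_sub hceil, Nat.cast_one]
      linarith
  have h := lPlusC_div_factorial_tn_pureGrabber_all (θ - n) n γ g (by linarith) (by linarith) hγ hg0 hg1 lam hlam r c' hr hc'
  simpa only [sub_add_cancel] using h

end HypergeomCM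

end Summit.CriticalPhenomena.PercolationContinuityZ3.Theorems
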